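import Literature.MathematicalPhysics.QuantumFieldTheory.Balaban1983to89.B9SmoothHolderClassTClosure

/-!
# `Balaban1983to89.B9SmoothHolderClassP` — THE PRINT-WEIGHTED transported Hölder classes `bHZP g s = (Lʲη)^{s−1}·‖·‖_{bHZT g s s}` (sites), `bHZKP g s` (bonds)
# and their GRADED versions `bHZPG g w ∕ bHZKPG g w`: the intermediate class of Theorem 3.1 whose unit member is LITERALLY print's input functional
# `‖F‖^{ξ}_s + |F| ≦ 2·Lʲη` of (3.44)∕(3.45) — sup channel AND seminorm channel both certify length-dimension 1 (LOCATED-U6, `BH13-UNITS-MEMO.md`)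

T. Bałaban, *Propagators for lattice gauge theories in a background field*, Commun. Math. Phys. **99** (1985) 389–434
[`Balaban1985BackgroundPropagators`, "B9"]; [4] = T. Bałaban, *Propagators and renormalization transformations for lattice gauge
theories. II*, Commun. Math. Phys. **96** (1984) 223–250 [`Balaban1984PropagatorsII`].

statement-level skeleton of published theorems with citation tags; proofs where landed; nothing here is a claim about the
Yang–Mills mass gap

THE PRINTED LOCI (held text `paper:balaban1985-cmp99-background-propagators` pp. 397–398, re-read).  (3.40) p. 397: *"‖A‖_α = max sup_{x,x′:|x−x′|≦1}
|x − x′|^{−α}|R(U(Γ_{x,x′}))A(x′) − A(x)| … It is understood that the η-scale is used in the above definitions.  If we use another scale, then it is indicated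
explicitly by a superscript"*; Thm 3.1 (3.43) p. 398: *"‖ζ∇_UG′(U)λ‖_β, ‖ζG′(U)∇\*_Uλ‖_β ≦ B₀(β)(Lʲη)^{1−β}(‖ζ‖^ξ_β + |ζ|)e^{−δ₀d(y,y′)}|λ|"*; (3.44)–(3.45) p. 398:
*"|(∇_UG′(U)∇\*_Uλ)(x)| ≦ B′₀(ε)e^{−δ₀d(y,y′)}(‖λ‖^{ξ′}_ε + |λ|) … ‖ζ∇_UG′(U)∇\*_Uλ‖_β ≦ B′₀(ε,β)(Lʲη)^{−β}(…)e^{−δ₀d(y,y′)}(‖λ‖^{ξ′}_{β+ε} + |λ|)"*, `ξ′ = Lʲ′η` the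
scale of the source block: at the η-scale `‖λ‖^{ξ′}_s + |λ| = (Lʲ′η)^s·‖λ‖_{s,η} + |λ|`.

WHY THIS FILE (cell `pub-ymgap`, node N06, seat dag-n06-l g24; repair (A′) of LOCATED-U6).  The option-(2) classes `bHZT g s p` (`B9SmoothHolderClassT`) measure
`(Lʲη)^{−p}·sup_{Δ̃(y)}|F| + ‖F‖_{s,η,y}`: a unit member is certified `|F| ≤ (Lʲη)^p` but only `‖F‖_{s,η} ≤ 1` — oscillation-dimension `s` — whereas every object on the
rows-20–21 Hölder paths (`G′∇\*λ`, `R∇\*G₁λ`) has length-dimension 1 in BOTH channels ((3.43): sup `(Lʲη)¹`, seminorm `(Lʲη)^{1−β}`).  The certificate's pin (P2)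
compensated with an outer `(Lʲη)⁻¹` on the graded class, which over-pays in the sup channel (the displayed producer `rgdH` then asks a `𝔠⁽⁰⁾ → 𝔠⁽²⁾` bound for a
dimension-1 operator) while the seminorm channel of the displayed consumer inputs at `bHZKT s 1 → cNorm … 1` stays short by `(Lʲη)^{1−s}` (`BH13-UNITS-MEMO.md` §1).
THE BALANCED CLASS: weight `(Lʲη)^{−1}` on the sup channel and `(Lʲη)^{s−1}` on the seminorm channel —
    ‖F‖_{s,y} := (Lʲη)⁻¹·sup_{Δ̃(y)}|F| + (Lʲη)^{s−1}·sup_{near pairs based in Δ̃(y)} (η|z−z′|_T)^{−s}|Δ^U F|  =  Wscl (1−s) y · (bHZT g (ε:=s) (p:=s)).loc y F,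
so that a unit member has EXACTLY `‖F‖^{ξ}_s + |F| ≤ 2·Lʲη`; then (3.43) reads `𝔠⁽⁰⁾ → bHZP s`, (3.44) reads `bHZKP s → 𝔠⁽¹⁾`, (3.45) reads `bHZKP (β+ε) → 𝔠_P^{(β−1)}`, all
with length-free constants (up to [4] (2.60) for `Lʲη` vs `Lʲ′η`).  THIS FILE:
* §1 `bHZT_loc_mono₂` (the transported site size is monotone in BOTH the exponent and the sup power), ★★ `bHZP g s` := `weightNorm (bHZT g s s) (Wscl (1−s))`;
  `bHZP_κ` (= `1 + C_Lip`, rfl), `bHZP_loc`, ★ `bHZP_loc_print` (at print's units: `(len y)⁻¹·sup + (len y)^{s−1}·pair_s`), `bHZP_isLoc_iff`, `bHZP_cut_apply`,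
  `bHZP_isLoc_of_blkOf`, `bHZP_loc_le_dom` (≤ the `s = 1` envelope `Wscl 1·(bHZT g 1 1).loc`);
* §2 ★★ `bHZPG g w` := `BlockNorm.graded` of the family `s ↦ bHZP g s` over `s ∈ (0,1)` (weights `0 ≤ w ≤ 1`, base index `1∕2`, cost `1 + C_Lip`, dominated by the
  envelope); `bHZPG_κ ∕ _cut ∕ _isLoc ∕ _isLoc_iff ∕ _cut_apply ∕ _isLoc_of_blkOf`, ★★ `hasMaj_from_bHZPG` (project to one exponent, constant `(w s)⁻¹`), ★★
  `hasMaj_into_bHZPG` (land once from the ∀s family, `w s·K s ≤ K₀`), `hasMaj_into_bHZPG_of_le` (s-uniform majorant), `bHZP_loc_le_bHZPG`;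
* §3–§4 the bond twins `bHZKT_loc_mono₂`, ★★ `bHZKP g s`, ★★ `bHZKPG g w` with the same API (`…_isLoc_of_blkV1`).
The PIN RECIPE (P1′)(P2′) of the memo reads `bH13 x U := bHZPG x.toKIdx (trBasis N) (taxiS … U) w13`, `bXH x U := bHZKPG … (taxiB … U) wX` — no outer weight.
HONEST SCOPE.  Definitions + bookkeeping over landed objects (my `bHZT ∕ bHZKT`, dag-n06-w6's `BlockNorm.graded`); nothing of [B9]∕[4] asserted; no majorant, no pin, no
certificate edit; COUNT-NEUTRAL; N06 NOT discharged; nothing continuum, nothing about the mass gap.  Cell `pub-ymgap` (HUMAN RULING D-0062), Track A node N06 [B9],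
seat `pub-ymgap-dag-n06-l` (g24), 2026-08-29.
-/

noncomputable section

namespace Literature.MathematicalPhysics.QuantumFieldTheory.Balaban1983to89.B9SmoothHolderClassP

open B6Geom246MultiLevelBox (blkOf)
open B6GlobalChartV1 (PV blkV1)
open B6Ineq2142KLevelV1 (β lvl)
open B6KLevelCensusIndexV1 (KIdx)
open B6Prop22KLevelTorusCensusEta (nKT)
open B9GeoNormsKLevelV1 (geo9K)
open B9GeoLemma21KLevelV1 (geo9K_len_pos)
open B9Thm34Ext (toB6)
open B9SectDSup (weightNorm weightNorm_loc)
open B11SectG (BlockNorm HasMaj)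
open B11SectGGlobal (Size)
open B11SectGGlobalSizes
open B11SectGSmoothCutT (Size.ofPairsT ofPairsT_sz_mono_weight)
open B11SectGGradedClass (graded_κ graded_isLoc graded_cut hasMaj_from_graded hasMaj_into_graded le_graded_loc member_loc_le)
open B9CoReadingCoords (XBK)
open B9CoReadingCoordsS (XSK)
open B9MultiscaleSmoothPartitionY (zeta NearY)
open B9MultiscaleSmoothPartitionYLip (CLip CLip_nonneg)
open B9SmoothHolderClassS (NearPair wEta wEta_nonneg Wscl Wscl_nonneg Wscl_mono one_le_Wscl)
open B9SmoothHolderClassK (srcY NearPairK wEtaK wEtaK_nonneg)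
open B9SmoothHolderClassT (trDif bHZT bHZT_κ bHZT_loc bHZT_isLoc_iff bHZT_cut_apply bHZT_isLoc_of_blkOf bHZKT bHZKT_κ bHZKT_loc bHZKT_isLoc_iff
  bHZKT_cut_apply bHZKT_isLoc_of_blkV1)
open B9SmoothHolderClassGraded (Expo expoHalf wE wEta_mono wEtaK_mono bHZT_loc_mono bHZKT_loc_mono)
open B9SmoothHolderClassTClosure (len_rpow_neg_eq_Wscl)
open Node00 (SiteY FBondY IBondY toKT levY)

variable {d ℓ : ℕ} {hd : 1 ≤ d + 1} {hL : Odd (ℓ + 1) ∧ 1 < ℓ + 1} {b₀ b₁ : ℝ}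
variable {𝔸 : Type} [NormedRing 𝔸] [NormedAlgebra ℂ 𝔸]
variable {κ : Type} [Fintype κ]
variable (i : KIdx d ℓ hd hL b₀ b₁) [Fintype (geo9K i).Site] (b : Module.Basis κ ℝ 𝔸)

/-! ## §1 ★★ The print-weighted transported site class `bHZP g s` -/

section Site

variable (g : SiteY i → SiteY i → 𝔸ˣ) {R : ℝ} {H : Prop}

/-- the transported site size is monotone in BOTH the pair exponent and the sup power: `s ≤ s′`, `p ≤ p′` ⇒ `loc^{(s,p)} ≤ loc^{(s′,p′)}` (`Lʲη ≤ 1`,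
`η|Δz|_T ≤ 1` on near pairs). [cite: Balaban1984PropagatorsII, (2.1) p.224 («Lʲη ≦ 1»); Balaban1985BackgroundPropagators, (3.40) p.397] -/
theorem bHZT_loc_mono₂ {s p s' p' : ℝ} (hs0 : 0 ≤ s) (hs1 : s ≤ 1) (hsp : s ≤ p) (hs0' : 0 ≤ s') (hs1' : s' ≤ 1) (hsp' : s' ≤ p') (hss : s ≤ s') (hpp : p ≤ p')
    (y : IBondY i) (F : XSK κ i → ℝ) :
    (bHZT (κ := κ) i b g (R := R) (H := H) hs0 hs1 hsp).loc y F ≤ (bHZT (κ := κ) i b g (R := R) (H := H) hs0' hs1' hsp').loc y F := by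
  classical
  rw [bHZT_loc, bHZT_loc]
  exact add_le_add (mul_le_mul_of_nonneg_right (Wscl_mono i hpp y) (Size.nonneg _ _ _))
    (ofPairsT_sz_mono_weight (g := toB6 (geo9K i) R H) (fun (q : XSK κ i) (y : IBondY i) => NearY i y q.1) (NearPair i) (wEta i s)
      (wEta_nonneg i s) (trDif b g) (wEta_nonneg i s') (fun q q' _ hP => wEta_mono i hss hP) F)

/-- ★★ **THE PRINT-WEIGHTED TRANSPORTED SITE CLASS `bHZP g s`**: the exponent-`s` transported class with sup power `s`, re-weighted by `(Lʲη)^{s−1} = Wscl (1−s)`: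
`loc y F = (Lʲη)^{s−1}·[(Lʲη)^{−s}·sup_{Δ̃(y)}|F| + sup_{near pairs}(η|Δz|_T)^{−s}|Δ^U F|] = (Lʲη)⁻¹·sup + (Lʲη)^{s−1}·‖F‖_{s,η,y}` — a unit member has print's
`‖F‖^{ξ}_s + |F| ≤ 2·Lʲη` ((3.44)∕(3.45) input functional; (3.43)'s output `(Lʲη)^{1−s}`, `(Lʲη)¹`); same cut `ζ_y·`, same `IsLoc`, κ = `1 + C_Lip`.
[cite: Balaban1985BackgroundPropagators, (3.40) p.397 + (3.43)–(3.45) p.398 («(Lʲη)^{1−β}», «‖λ‖^{ξ′}_ε + |λ|»); Balaban1984PropagatorsII, (2.51)–(2.52) p.232, (2.1) p.224] -/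
def bHZP {s : ℝ} (hs0 : 0 ≤ s) (hs1 : s ≤ 1) : BlockNorm (toB6 (geo9K i) R H) (XSK κ i → ℝ) :=
  weightNorm (bHZT (κ := κ) i b g (R := R) (H := H) (ε := s) (p := s) hs0 hs1 le_rfl) (Wscl i (1 - s)) (Wscl_nonneg i (1 - s))

variable {s : ℝ} (hs0 : 0 ≤ s) (hs1 : s ≤ 1)

/-- the cutting cost is `1 + C_Lip(d, L)` for every table and exponent. [cite: Balaban1984PropagatorsII, (2.52) p.232; Balaban1985BackgroundPropagators, (3.43) p.398] -/
theorem bHZP_κ : (bHZP (κ := κ) i b g (R := R) (H := H) hs0 hs1).κ = 1 + CLip d ℓ := rfl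

open Classical in
/-- the local size: `Wscl (1−s) y·[Wscl s y·sup_{Δ̃(y)}|F| + pair_s]`. [cite: Balaban1985BackgroundPropagators, (3.40) p.397 + (3.43) p.398, bookkeeping] -/
theorem bHZP_loc (y : IBondY i) (F : XSK κ i → ℝ) :
    (bHZP (κ := κ) i b g (R := R) (H := H) hs0 hs1).loc y F = Wscl i (1 - s) y *
      (Wscl i s y * (Size.ofSup (toB6 (geo9K i) R H) (fun (q : XSK κ i) (y : IBondY i) => NearY i y q.1)).sz y F +
        (Size.ofPairsT (toB6 (geo9K i) R H) (fun (q : XSK κ i) (y : IBondY i) => NearY i y q.1) (NearPair i) (wEta i s) (wEta_nonneg i s)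
          (trDif b g)).sz y F) := by
  rw [bHZP, weightNorm_loc, bHZT_loc]

open Classical in
/-- ★ **THE PRINT-LITERAL READING AT PRINT'S UNITS** (`|c_f| = Lᵏ`, `len y = Lʲη`): `loc y F = (Lʲη)⁻¹·sup_{Δ̃(y)}|F| + (Lʲη)^{s−1}·pair_s` — sup channel weight
`(Lʲη)⁻¹`, seminorm channel weight `(Lʲη)^{s−1}`: BOTH certify length-dimension 1. [cite: Balaban1985BackgroundPropagators, (3.43)–(3.45) p.398; Balaban1984PropagatorsII, (2.1) p.224] -/
theorem bHZP_loc_print (hcf : |i.cf| = (nKT (toKT i) : ℝ)) (y : IBondY i) (F : XSK κ i → ℝ) :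
    (bHZP (κ := κ) i b g (R := R) (H := H) hs0 hs1).loc y F =
      ((geo9K i).len y)⁻¹ * (Size.ofSup (toB6 (geo9K i) R H) (fun (q : XSK κ i) (y : IBondY i) => NearY i y q.1)).sz y F +
        (geo9K i).len y ^ (s - 1) * (Size.ofPairsT (toB6 (geo9K i) R H) (fun (q : XSK κ i) (y : IBondY i) => NearY i y q.1) (NearPair i) (wEta i s)
          (wEta_nonneg i s) (trDif b g)).sz y F := by
  have hΛ : 0 < (geo9K i).len y := geo9K_len_pos i y
  rw [bHZP_loc, ← len_rpow_neg_eq_Wscl i hcf, ← len_rpow_neg_eq_Wscl i hcf, mul_add, ← mul_assoc, ← Real.rpow_add hΛ,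
    show -(1 - s) + -s = (-1 : ℝ) by ring, Real.rpow_neg_one, neg_sub]

/-- localisation at `y` = the vector vanishes off `Δ̃(y)` (the predicate of `bHZT`). [cite: Balaban1985BackgroundPropagators, (3.44) p.398, bookkeeping] -/
theorem bHZP_isLoc_iff (y : IBondY i) (F : XSK κ i → ℝ) :
    (bHZP (κ := κ) i b g (R := R) (H := H) hs0 hs1).IsLoc y F ↔ ∀ q : XSK κ i, ¬ NearY i y q.1 → F q = 0 :=
  bHZT_isLoc_iff i b g (R := R) (H := H) hs0 hs1 le_rfl y F

/-- the cut-off is the multiplication by `ζ_y`. [cite: Balaban1985BackgroundPropagators, (3.43) p.398, bookkeeping] -/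
theorem bHZP_cut_apply (y : IBondY i) (F : XSK κ i → ℝ) (q : XSK κ i) :
    (bHZP (κ := κ) i b g (R := R) (H := H) hs0 hs1).cut y F q = zeta i y q.1 * F q :=
  bHZT_cut_apply i b g (R := R) (H := H) hs0 hs1 le_rfl y F q

/-- sharp localisation over the carrier block implies localisation in `bHZP`. [cite: Balaban1985BackgroundPropagators, (3.44) p.398, bookkeeping] -/
theorem bHZP_isLoc_of_blkOf (y : IBondY i) (F : XSK κ i → ℝ) (hF : ∀ q : XSK κ i, blkOf i.D.toDomains q.1 ≠ β i.hN i.D i.hk y → F q = 0) :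
    (bHZP (κ := κ) i b g (R := R) (H := H) hs0 hs1).IsLoc y F :=
  bHZT_isLoc_of_blkOf i b g (R := R) (H := H) hs0 hs1 le_rfl y F hF

/-- every print-weighted member is dominated by the `s = 1` ENVELOPE `Wscl 1·loc_{bHZT g 1 1}` (`(Lʲη)^{s−1} ≤ (Lʲη)^{−1}`, sizes monotone in `(s, p)`).
[cite: Balaban1984PropagatorsII, (2.1) p.224 («Lʲη ≦ 1»); Balaban1985BackgroundPropagators, (3.40) p.397, bookkeeping] -/
theorem bHZP_loc_le_dom (y : IBondY i) (F : XSK κ i → ℝ) :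
    (bHZP (κ := κ) i b g (R := R) (H := H) hs0 hs1).loc y F ≤
      Wscl i 1 y * (bHZT (κ := κ) i b g (R := R) (H := H) (ε := 1) (p := 1) zero_le_one le_rfl le_rfl).loc y F := by
  rw [bHZP, weightNorm_loc]
  exact mul_le_mul (Wscl_mono i (by linarith) y) (bHZT_loc_mono₂ i b g hs0 hs1 le_rfl zero_le_one le_rfl le_rfl hs1 hs1 y F)
    ((bHZT i b g hs0 hs1 le_rfl).loc_nonneg y F) (Wscl_nonneg i 1 y)

end Site

/-! ## §2 ★★ The graded print-weighted site class `bHZPG g w` -/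

section SiteGraded

variable (g : SiteY i → SiteY i → 𝔸ˣ) {R : ℝ} {H : Prop}

/-- the exponent-indexed FAMILY `s ↦ bHZP g s`, `s ∈ (0,1)`. [cite: Balaban1985BackgroundPropagators, (3.43) p.398, dictionary] -/
def famSP : Expo → BlockNorm (toB6 (geo9K i) R H) (XSK κ i → ℝ) := fun s => bHZP (κ := κ) i b g (R := R) (H := H) (s := s.1) s.2.1.le s.2.2.le

/-- ★★ **THE GRADED PRINT-WEIGHTED SITE CLASS `bHZPG g w`**: `loc_* y F = ⨆_{s∈(0,1)} w(s)·[(Lʲη)⁻¹sup_{Δ̃(y)}|F| + (Lʲη)^{s−1}‖F‖_{s,η,y}]`, weights `0 ≤ w ≤ 1`, base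
index `1∕2`, cost `1 + C_Lip`, dominated by the `s = 1` envelope — the PIN (P2′): `bH13 x U := bHZPG … (taxiS … U) w13` (no outer weight).
[cite: Balaban1985BackgroundPropagators, Thm 3.1 p.397 («B₀(β) → ∞ if β → 1») + (3.43)–(3.45) p.398; Balaban1984PropagatorsII, (2.51)–(2.52) p.232] -/
def bHZPG (w : ℝ → ℝ) (hw0 : ∀ s, 0 ≤ w s) (hw1 : ∀ s, w s ≤ 1) : BlockNorm (toB6 (geo9K i) R H) (XSK κ i → ℝ) :=
  BlockNorm.graded (famSP (κ := κ) i b g (R := R) (H := H)) expoHalf (wE w) (1 + CLip d ℓ)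
    (fun y F => Wscl i 1 y * (bHZT (κ := κ) i b g (R := R) (H := H) (ε := 1) (p := 1) zero_le_one le_rfl le_rfl).loc y F)
    (fun s => hw0 s.1) (fun _ => rfl) (fun s => le_of_eq (bHZP_κ i b g s.2.1.le s.2.2.le))
    (fun s y F => (mul_le_of_le_one_left ((bHZP i b g s.2.1.le s.2.2.le).loc_nonneg y F) (hw1 s.1)).trans (bHZP_loc_le_dom i b g s.2.1.le s.2.2.le y F))

variable (w : ℝ → ℝ) (hw0 : ∀ s, 0 ≤ w s) (hw1 : ∀ s, w s ≤ 1)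

/-- ★ the cutting cost is `1 + C_Lip(d, L)`. [cite: Balaban1984PropagatorsII, (2.52) p.232; Balaban1985BackgroundPropagators, (3.43) p.398] -/
theorem bHZPG_κ : (bHZPG (κ := κ) i b g (R := R) (H := H) w hw0 hw1).κ = 1 + CLip d ℓ := rfl

/-- the cut-offs are those of the exponent-`1∕2` member (= every member's). [cite: Balaban1984PropagatorsII, (2.52) p.232, bookkeeping] -/
theorem bHZPG_cut : (bHZPG (κ := κ) i b g (R := R) (H := H) w hw0 hw1).cut =
    (bHZP (κ := κ) i b g (R := R) (H := H) (s := 1 / 2) expoHalf.2.1.le expoHalf.2.2.le).cut := rfl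

/-- the localisation predicate is that of the exponent-`1∕2` member. [cite: Balaban1984PropagatorsII, (2.51) p.232, bookkeeping] -/
theorem bHZPG_isLoc : (bHZPG (κ := κ) i b g (R := R) (H := H) w hw0 hw1).IsLoc =
    (bHZP (κ := κ) i b g (R := R) (H := H) (s := 1 / 2) expoHalf.2.1.le expoHalf.2.2.le).IsLoc := rfl

/-- localisation at `y` = the vector vanishes off `Δ̃(y)`. [cite: Balaban1985BackgroundPropagators, (3.44) p.398, bookkeeping] -/
theorem bHZPG_isLoc_iff (y : IBondY i) (F : XSK κ i → ℝ) :
    (bHZPG (κ := κ) i b g (R := R) (H := H) w hw0 hw1).IsLoc y F ↔ ∀ q : XSK κ i, ¬ NearY i y q.1 → F q = 0 := by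
  rw [bHZPG_isLoc]; exact bHZP_isLoc_iff i b g _ _ y F

/-- the cut-off is the multiplication by `ζ_y`. [cite: Balaban1985BackgroundPropagators, (3.43) p.398, bookkeeping] -/
theorem bHZPG_cut_apply (y : IBondY i) (F : XSK κ i → ℝ) (q : XSK κ i) :
    (bHZPG (κ := κ) i b g (R := R) (H := H) w hw0 hw1).cut y F q = zeta i y q.1 * F q := by
  rw [bHZPG_cut]; exact bHZP_cut_apply i b g _ _ y F q

/-- sharp localisation over the carrier block implies localisation in `bHZPG`. [cite: Balaban1985BackgroundPropagators, (3.44) p.398, bookkeeping] -/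
theorem bHZPG_isLoc_of_blkOf (y : IBondY i) (F : XSK κ i → ℝ) (hF : ∀ q : XSK κ i, blkOf i.D.toDomains q.1 ≠ β i.hN i.D i.hk y → F q = 0) :
    (bHZPG (κ := κ) i b g (R := R) (H := H) w hw0 hw1).IsLoc y F := by
  rw [bHZPG_isLoc]; exact bHZP_isLoc_of_blkOf i b g _ _ y F hF

variable {F₁ F₂ : Type} [AddCommGroup F₁] [Module ℝ F₁] [AddCommGroup F₂] [Module ℝ F₂]

/-- ★★ **OUT OF THE GRADED CLASS AT ONE EXPONENT** (the consumer's projection, e.g. (3.44) at `s`, (3.45) at `s = β + ε`): a majorant `K ≥ 0` of `T` out of `bHZP g s`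
(`0 < s < 1`, `0 < w s`) is the majorant `(w s)⁻¹·K` out of `bHZPG`. [cite: Balaban1985BackgroundPropagators, (3.44)–(3.45) p.398 («B′₀(ε), B′₀(ε,β)»); Balaban1984PropagatorsII, (2.51) p.232] -/
theorem hasMaj_from_bHZPG {b₂ : BlockNorm (toB6 (geo9K i) R H) F₂} {T : (XSK κ i → ℝ) →ₗ[ℝ] F₂} {K : IBondY i → IBondY i → ℝ}
    {s : ℝ} (hs0 : 0 < s) (hs1 : s < 1) (hws : 0 < w s) (hK : ∀ a c, 0 ≤ K a c)
    (h : HasMaj (bHZP (κ := κ) i b g (R := R) (H := H) (s := s) hs0.le hs1.le) b₂ T K) :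
    HasMaj (bHZPG (κ := κ) i b g (R := R) (H := H) w hw0 hw1) b₂ T (fun y y' => (w s)⁻¹ * K y y') := by
  unfold bHZPG
  exact hasMaj_from_graded (b := famSP (κ := κ) i b g (R := R) (H := H)) (i₀ := expoHalf) (w := wE w) (⟨s, hs0, hs1⟩ : Expo) hws (fun _ _ hl => hl) hK h

/-- ★★ **INTO THE GRADED CLASS FROM THE WHOLE FAMILY** (the producer lands once, e.g. (3.43) ∀s with `w(s)·B₀(s) ≤ B`): majorants `K s` into every `bHZP g s` with
`w(s)·K s ≤ K₀` give the majorant `K₀` into `bHZPG`. [cite: Balaban1985BackgroundPropagators, Thm 3.1 p.397 («B₀(β) → ∞ if β → 1») + (3.43) p.398; Balaban1984PropagatorsII, (2.51) p.232] -/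
theorem hasMaj_into_bHZPG {b₁ : BlockNorm (toB6 (geo9K i) R H) F₁} {T : F₁ →ₗ[ℝ] (XSK κ i → ℝ)} {K : ℝ → IBondY i → IBondY i → ℝ}
    {K₀ : IBondY i → IBondY i → ℝ} (hK₀ : ∀ a c, 0 ≤ K₀ a c) (hKle : ∀ s, 0 < s → s < 1 → ∀ a c, w s * K s a c ≤ K₀ a c)
    (h : ∀ (s : ℝ) (hs0 : 0 < s) (hs1 : s < 1), HasMaj b₁ (bHZP (κ := κ) i b g (R := R) (H := H) (s := s) hs0.le hs1.le) T (K s)) :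
    HasMaj b₁ (bHZPG (κ := κ) i b g (R := R) (H := H) w hw0 hw1) T K₀ := by
  unfold bHZPG
  exact hasMaj_into_graded (b := famSP (κ := κ) i b g (R := R) (H := H)) (i₀ := expoHalf) (w := wE w)
    (K := fun s : Expo => K s.1) hK₀ (fun s => hKle s.1 s.2.1 s.2.2) fun s => h s.1 s.2.1 s.2.2

/-- INTO the graded class from an s-UNIFORM majorant `K ≥ 0` (weights `≤ 1`) — the shape of (3.43) + (3.42)₂ read through the gradient-member adapter
`B9SmoothHolderClassTFromGradient.hasMaj_into_bHZT_printWeight_of_grad`. [cite: Balaban1985BackgroundPropagators, (3.43) p.398; Balaban1984PropagatorsII, (2.51) p.232] -/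
theorem hasMaj_into_bHZPG_of_le {b₁ : BlockNorm (toB6 (geo9K i) R H) F₁} {T : F₁ →ₗ[ℝ] (XSK κ i → ℝ)} {K : IBondY i → IBondY i → ℝ}
    (hK : ∀ a c, 0 ≤ K a c) (h : ∀ (s : ℝ) (hs0 : 0 < s) (hs1 : s < 1), HasMaj b₁ (bHZP (κ := κ) i b g (R := R) (H := H) (s := s) hs0.le hs1.le) T K) :
    HasMaj b₁ (bHZPG (κ := κ) i b g (R := R) (H := H) w hw0 hw1) T K :=
  hasMaj_into_bHZPG i b g w hw0 hw1 (K := fun _ => K) hK (fun s _ _ a c => mul_le_of_le_one_left (hK a c) (hw1 s)) h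

/-- a member size is controlled by the graded size: `loc_{bHZP g s} ≤ (w s)⁻¹·loc_*` (`0 < s < 1`, `0 < w s`). [cite: Balaban1985BackgroundPropagators, (3.45) p.398, bookkeeping] -/
theorem bHZP_loc_le_bHZPG {s : ℝ} (hs0 : 0 < s) (hs1 : s < 1) (hws : 0 < w s) (y : IBondY i) (F : XSK κ i → ℝ) :
    (bHZP (κ := κ) i b g (R := R) (H := H) (s := s) hs0.le hs1.le).loc y F ≤ (w s)⁻¹ * (bHZPG (κ := κ) i b g (R := R) (H := H) w hw0 hw1).loc y F := by
  unfold bHZPG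
  exact member_loc_le (b := famSP (κ := κ) i b g (R := R) (H := H)) (i₀ := expoHalf) (w := wE w) (⟨s, hs0, hs1⟩ : Expo) hws _ _

end SiteGraded

/-! ## §3 ★★ The print-weighted transported bond class `bHZKP g s` -/

section Bond

variable (g : FBondY i → FBondY i → 𝔸ˣ) {R : ℝ} {H : Prop}

/-- the transported bond size is monotone in both the pair exponent and the sup power. [cite: Balaban1984PropagatorsII, (2.1) p.224; Balaban1985BackgroundPropagators, (3.40) p.397] -/
theorem bHZKT_loc_mono₂ {s p s' p' : ℝ} (hs0 : 0 ≤ s) (hs1 : s ≤ 1) (hsp : s ≤ p) (hs0' : 0 ≤ s') (hs1' : s' ≤ 1) (hsp' : s' ≤ p') (hss : s ≤ s') (hpp : p ≤ p')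
    (y : IBondY i) (F : XBK κ i → ℝ) :
    (bHZKT (κ := κ) i b g (R := R) (H := H) hs0 hs1 hsp).loc y F ≤ (bHZKT (κ := κ) i b g (R := R) (H := H) hs0' hs1' hsp').loc y F := by
  classical
  rw [bHZKT_loc, bHZKT_loc]
  exact add_le_add (mul_le_mul_of_nonneg_right (Wscl_mono i hpp y) (Size.nonneg _ _ _))
    (ofPairsT_sz_mono_weight (g := toB6 (geo9K i) R H) (fun (q : XBK κ i) (y : IBondY i) => NearY i y (srcY i q)) (NearPairK i) (wEtaK i s)
      (wEtaK_nonneg i s) (trDif b g) (wEtaK_nonneg i s') (fun q q' _ hP => wEtaK_mono i hss hP) F)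

/-- ★★ **THE PRINT-WEIGHTED TRANSPORTED BOND CLASS `bHZKP g s`** := `weightNorm (bHZKT g s s) (Wscl (1−s))`: `loc = (Lʲη)⁻¹·sup + (Lʲη)^{s−1}·‖·‖_{s,η}` on the bond carrier
— the class in which (3.44) reads `bHZKP s → 𝔠⁽¹⁾` and (3.45) reads `bHZKP (β+ε) → 𝔠_P^{(β−1)}` with length-free constants; the PIN (P1′): `bXH x U := bHZKPG … (taxiB … U) wX`.
[cite: Balaban1985BackgroundPropagators, (3.40) p.397 + (3.43)–(3.45) p.398 + p.398 (remark after (3.47)); Balaban1984PropagatorsII, (2.51)–(2.52) p.232, (2.137) p.247] -/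
def bHZKP {s : ℝ} (hs0 : 0 ≤ s) (hs1 : s ≤ 1) : BlockNorm (toB6 (geo9K i) R H) (XBK κ i → ℝ) :=
  weightNorm (bHZKT (κ := κ) i b g (R := R) (H := H) (ε := s) (p := s) hs0 hs1 le_rfl) (Wscl i (1 - s)) (Wscl_nonneg i (1 - s))

variable {s : ℝ} (hs0 : 0 ≤ s) (hs1 : s ≤ 1)

/-- ★ the cutting cost is `1 + C_Lip(d, L)`. [cite: Balaban1984PropagatorsII, (2.52) p.232; Balaban1985BackgroundPropagators, (3.43) p.398] -/
theorem bHZKP_κ : (bHZKP (κ := κ) i b g (R := R) (H := H) hs0 hs1).κ = 1 + CLip d ℓ := rfl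

open Classical in
/-- the local size: `Wscl (1−s) y·[Wscl s y·sup_{bonds sourced in Δ̃(y)}|F| + pair_s]`. [cite: Balaban1985BackgroundPropagators, (3.40) p.397 + (3.43) p.398, bookkeeping] -/
theorem bHZKP_loc (y : IBondY i) (F : XBK κ i → ℝ) :
    (bHZKP (κ := κ) i b g (R := R) (H := H) hs0 hs1).loc y F = Wscl i (1 - s) y *
      (Wscl i s y * (Size.ofSup (toB6 (geo9K i) R H) (fun (q : XBK κ i) (y : IBondY i) => NearY i y (srcY i q))).sz y F +
        (Size.ofPairsT (toB6 (geo9K i) R H) (fun (q : XBK κ i) (y : IBondY i) => NearY i y (srcY i q)) (NearPairK i) (wEtaK i s) (wEtaK_nonneg i s)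
          (trDif b g)).sz y F) := by
  rw [bHZKP, weightNorm_loc, bHZKT_loc]

open Classical in
/-- ★ the print-literal reading at print's units: `loc y F = (Lʲη)⁻¹·sup + (Lʲη)^{s−1}·pair_s`. [cite: Balaban1985BackgroundPropagators, (3.43)–(3.45) p.398; Balaban1984PropagatorsII, (2.1) p.224] -/
theorem bHZKP_loc_print (hcf : |i.cf| = (nKT (toKT i) : ℝ)) (y : IBondY i) (F : XBK κ i → ℝ) :
    (bHZKP (κ := κ) i b g (R := R) (H := H) hs0 hs1).loc y F =
      ((geo9K i).len y)⁻¹ * (Size.ofSup (toB6 (geo9K i) R H) (fun (q : XBK κ i) (y : IBondY i) => NearY i y (srcY i q))).sz y F +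
        (geo9K i).len y ^ (s - 1) * (Size.ofPairsT (toB6 (geo9K i) R H) (fun (q : XBK κ i) (y : IBondY i) => NearY i y (srcY i q)) (NearPairK i) (wEtaK i s)
          (wEtaK_nonneg i s) (trDif b g)).sz y F := by
  have hΛ : 0 < (geo9K i).len y := geo9K_len_pos i y
  rw [bHZKP_loc, ← len_rpow_neg_eq_Wscl i hcf, ← len_rpow_neg_eq_Wscl i hcf, mul_add, ← mul_assoc, ← Real.rpow_add hΛ,
    show -(1 - s) + -s = (-1 : ℝ) by ring, Real.rpow_neg_one, neg_sub]

/-- localisation at `y` = the bond vector vanishes at bonds sourced off `Δ̃(y)`. [cite: Balaban1985BackgroundPropagators, (3.44) p.398 + p.398 (remark after (3.47)), bookkeeping] -/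
theorem bHZKP_isLoc_iff (y : IBondY i) (F : XBK κ i → ℝ) :
    (bHZKP (κ := κ) i b g (R := R) (H := H) hs0 hs1).IsLoc y F ↔ ∀ q : XBK κ i, ¬ NearY i y (srcY i q) → F q = 0 :=
  bHZKT_isLoc_iff i b g (R := R) (H := H) hs0 hs1 le_rfl y F

/-- the cut-off is the multiplication by `ζ_y` at the charted source site. [cite: Balaban1985BackgroundPropagators, (3.43) p.398, bookkeeping] -/
theorem bHZKP_cut_apply (y : IBondY i) (F : XBK κ i → ℝ) (q : XBK κ i) :
    (bHZKP (κ := κ) i b g (R := R) (H := H) hs0 hs1).cut y F q = zeta i y (srcY i q) * F q :=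
  bHZKT_cut_apply i b g (R := R) (H := H) hs0 hs1 le_rfl y F q

/-- sharp localisation over the carrier block implies localisation in `bHZKP`. [cite: Balaban1985BackgroundPropagators, p.398 (remark after (3.47): «supp J ⊂ Δ(y′)»), bookkeeping] -/
theorem bHZKP_isLoc_of_blkV1 (y : IBondY i) (F : XBK κ i → ℝ) (hF : ∀ q : XBK κ i, blkV1 i.hN i.D q.1 ≠ β i.hN i.D i.hk y → F q = 0) :
    (bHZKP (κ := κ) i b g (R := R) (H := H) hs0 hs1).IsLoc y F :=
  bHZKT_isLoc_of_blkV1 i b g (R := R) (H := H) hs0 hs1 le_rfl y F hF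

/-- every print-weighted bond member is dominated by the `s = 1` envelope. [cite: Balaban1984PropagatorsII, (2.1) p.224, bookkeeping] -/
theorem bHZKP_loc_le_dom (y : IBondY i) (F : XBK κ i → ℝ) :
    (bHZKP (κ := κ) i b g (R := R) (H := H) hs0 hs1).loc y F ≤
      Wscl i 1 y * (bHZKT (κ := κ) i b g (R := R) (H := H) (ε := 1) (p := 1) zero_le_one le_rfl le_rfl).loc y F := by
  rw [bHZKP, weightNorm_loc]
  exact mul_le_mul (Wscl_mono i (by linarith) y) (bHZKT_loc_mono₂ i b g hs0 hs1 le_rfl zero_le_one le_rfl le_rfl hs1 hs1 y F)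
    ((bHZKT i b g hs0 hs1 le_rfl).loc_nonneg y F) (Wscl_nonneg i 1 y)

end Bond

/-! ## §4 ★★ The graded print-weighted bond class `bHZKPG g w` -/

section BondGraded

variable (g : FBondY i → FBondY i → 𝔸ˣ) {R : ℝ} {H : Prop}

/-- the exponent-indexed FAMILY `s ↦ bHZKP g s`, `s ∈ (0,1)`. [cite: Balaban1985BackgroundPropagators, (3.43) p.398, dictionary] -/
def famKP : Expo → BlockNorm (toB6 (geo9K i) R H) (XBK κ i → ℝ) := fun s => bHZKP (κ := κ) i b g (R := R) (H := H) (s := s.1) s.2.1.le s.2.2.le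

/-- ★★ **THE GRADED PRINT-WEIGHTED BOND CLASS `bHZKPG g w`** — the PIN (P1′) `bXH x U := bHZKPG … (taxiB … U) wX`.
[cite: Balaban1985BackgroundPropagators, Thm 3.1 p.397 + (3.43)–(3.45) p.398 + p.398 (remark after (3.47)); Balaban1984PropagatorsII, (2.51)–(2.52) p.232] -/
def bHZKPG (w : ℝ → ℝ) (hw0 : ∀ s, 0 ≤ w s) (hw1 : ∀ s, w s ≤ 1) : BlockNorm (toB6 (geo9K i) R H) (XBK κ i → ℝ) :=
  BlockNorm.graded (famKP (κ := κ) i b g (R := R) (H := H)) expoHalf (wE w) (1 + CLip d ℓ)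
    (fun y F => Wscl i 1 y * (bHZKT (κ := κ) i b g (R := R) (H := H) (ε := 1) (p := 1) zero_le_one le_rfl le_rfl).loc y F)
    (fun s => hw0 s.1) (fun _ => rfl) (fun s => le_of_eq (bHZKP_κ i b g s.2.1.le s.2.2.le))
    (fun s y F => (mul_le_of_le_one_left ((bHZKP i b g s.2.1.le s.2.2.le).loc_nonneg y F) (hw1 s.1)).trans (bHZKP_loc_le_dom i b g s.2.1.le s.2.2.le y F))

variable (w : ℝ → ℝ) (hw0 : ∀ s, 0 ≤ w s) (hw1 : ∀ s, w s ≤ 1)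

/-- ★ the cutting cost is `1 + C_Lip(d, L)`. [cite: Balaban1984PropagatorsII, (2.52) p.232; Balaban1985BackgroundPropagators, (3.43) p.398] -/
theorem bHZKPG_κ : (bHZKPG (κ := κ) i b g (R := R) (H := H) w hw0 hw1).κ = 1 + CLip d ℓ := rfl

/-- the cut-offs are those of the exponent-`1∕2` member. [cite: Balaban1984PropagatorsII, (2.52) p.232, bookkeeping] -/
theorem bHZKPG_cut : (bHZKPG (κ := κ) i b g (R := R) (H := H) w hw0 hw1).cut =
    (bHZKP (κ := κ) i b g (R := R) (H := H) (s := 1 / 2) expoHalf.2.1.le expoHalf.2.2.le).cut := rfl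

/-- the localisation predicate is that of the exponent-`1∕2` member. [cite: Balaban1984PropagatorsII, (2.51) p.232, bookkeeping] -/
theorem bHZKPG_isLoc : (bHZKPG (κ := κ) i b g (R := R) (H := H) w hw0 hw1).IsLoc =
    (bHZKP (κ := κ) i b g (R := R) (H := H) (s := 1 / 2) expoHalf.2.1.le expoHalf.2.2.le).IsLoc := rfl

/-- localisation at `y` = the bond vector vanishes at bonds sourced off `Δ̃(y)`. [cite: Balaban1985BackgroundPropagators, (3.44) p.398, bookkeeping] -/
theorem bHZKPG_isLoc_iff (y : IBondY i) (F : XBK κ i → ℝ) :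
    (bHZKPG (κ := κ) i b g (R := R) (H := H) w hw0 hw1).IsLoc y F ↔ ∀ q : XBK κ i, ¬ NearY i y (srcY i q) → F q = 0 := by
  rw [bHZKPG_isLoc]; exact bHZKP_isLoc_iff i b g _ _ y F

/-- the cut-off is the multiplication by `ζ_y` at the charted source site. [cite: Balaban1985BackgroundPropagators, (3.43) p.398, bookkeeping] -/
theorem bHZKPG_cut_apply (y : IBondY i) (F : XBK κ i → ℝ) (q : XBK κ i) :
    (bHZKPG (κ := κ) i b g (R := R) (H := H) w hw0 hw1).cut y F q = zeta i y (srcY i q) * F q := by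
  rw [bHZKPG_cut]; exact bHZKP_cut_apply i b g _ _ y F q

/-- sharp localisation over the carrier block implies localisation in `bHZKPG`. [cite: Balaban1985BackgroundPropagators, p.398 (remark after (3.47)), bookkeeping] -/
theorem bHZKPG_isLoc_of_blkV1 (y : IBondY i) (F : XBK κ i → ℝ) (hF : ∀ q : XBK κ i, blkV1 i.hN i.D q.1 ≠ β i.hN i.D i.hk y → F q = 0) :
    (bHZKPG (κ := κ) i b g (R := R) (H := H) w hw0 hw1).IsLoc y F := by
  rw [bHZKPG_isLoc]; exact bHZKP_isLoc_of_blkV1 i b g _ _ y F hF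

variable {F₁ F₂ : Type} [AddCommGroup F₁] [Module ℝ F₁] [AddCommGroup F₂] [Module ℝ F₂]

/-- ★★ **OUT OF THE GRADED BOND CLASS AT ONE EXPONENT** ((3.44) at `s`, (3.45) at `β + ε`): constant `(w s)⁻¹`. [cite: Balaban1985BackgroundPropagators, (3.44)–(3.45) p.398; Balaban1984PropagatorsII, (2.51) p.232] -/
theorem hasMaj_from_bHZKPG {b₂ : BlockNorm (toB6 (geo9K i) R H) F₂} {T : (XBK κ i → ℝ) →ₗ[ℝ] F₂} {K : IBondY i → IBondY i → ℝ}
    {s : ℝ} (hs0 : 0 < s) (hs1 : s < 1) (hws : 0 < w s) (hK : ∀ a c, 0 ≤ K a c)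
    (h : HasMaj (bHZKP (κ := κ) i b g (R := R) (H := H) (s := s) hs0.le hs1.le) b₂ T K) :
    HasMaj (bHZKPG (κ := κ) i b g (R := R) (H := H) w hw0 hw1) b₂ T (fun y y' => (w s)⁻¹ * K y y') := by
  unfold bHZKPG
  exact hasMaj_from_graded (b := famKP (κ := κ) i b g (R := R) (H := H)) (i₀ := expoHalf) (w := wE w) (⟨s, hs0, hs1⟩ : Expo) hws (fun _ _ hl => hl) hK h

/-- ★★ **INTO THE GRADED BOND CLASS FROM THE WHOLE FAMILY** (`w(s)·K s ≤ K₀`). [cite: Balaban1985BackgroundPropagators, Thm 3.1 p.397 + (3.43) p.398; Balaban1984PropagatorsII, (2.51) p.232] -/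
theorem hasMaj_into_bHZKPG {b₁ : BlockNorm (toB6 (geo9K i) R H) F₁} {T : F₁ →ₗ[ℝ] (XBK κ i → ℝ)} {K : ℝ → IBondY i → IBondY i → ℝ}
    {K₀ : IBondY i → IBondY i → ℝ} (hK₀ : ∀ a c, 0 ≤ K₀ a c) (hKle : ∀ s, 0 < s → s < 1 → ∀ a c, w s * K s a c ≤ K₀ a c)
    (h : ∀ (s : ℝ) (hs0 : 0 < s) (hs1 : s < 1), HasMaj b₁ (bHZKP (κ := κ) i b g (R := R) (H := H) (s := s) hs0.le hs1.le) T (K s)) :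
    HasMaj b₁ (bHZKPG (κ := κ) i b g (R := R) (H := H) w hw0 hw1) T K₀ := by
  unfold bHZKPG
  exact hasMaj_into_graded (b := famKP (κ := κ) i b g (R := R) (H := H)) (i₀ := expoHalf) (w := wE w)
    (K := fun s : Expo => K s.1) hK₀ (fun s => hKle s.1 s.2.1 s.2.2) fun s => h s.1 s.2.1 s.2.2

/-- INTO the graded bond class from an s-UNIFORM majorant `K ≥ 0` (weights `≤ 1`). [cite: Balaban1985BackgroundPropagators, (3.43) p.398; Balaban1984PropagatorsII, (2.51) p.232] -/
theorem hasMaj_into_bHZKPG_of_le {b₁ : BlockNorm (toB6 (geo9K i) R H) F₁} {T : F₁ →ₗ[ℝ] (XBK κ i → ℝ)} {K : IBondY i → IBondY i → ℝ}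
    (hK : ∀ a c, 0 ≤ K a c) (h : ∀ (s : ℝ) (hs0 : 0 < s) (hs1 : s < 1), HasMaj b₁ (bHZKP (κ := κ) i b g (R := R) (H := H) (s := s) hs0.le hs1.le) T K) :
    HasMaj b₁ (bHZKPG (κ := κ) i b g (R := R) (H := H) w hw0 hw1) T K :=
  hasMaj_into_bHZKPG i b g w hw0 hw1 (K := fun _ => K) hK (fun s _ _ a c => mul_le_of_le_one_left (hK a c) (hw1 s)) h

/-- a member size is controlled by the graded size: `loc_{bHZKP g s} ≤ (w s)⁻¹·loc_*`. [cite: Balaban1985BackgroundPropagators, (3.45) p.398, bookkeeping] -/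
theorem bHZKP_loc_le_bHZKPG {s : ℝ} (hs0 : 0 < s) (hs1 : s < 1) (hws : 0 < w s) (y : IBondY i) (F : XBK κ i → ℝ) :
    (bHZKP (κ := κ) i b g (R := R) (H := H) (s := s) hs0.le hs1.le).loc y F ≤ (w s)⁻¹ * (bHZKPG (κ := κ) i b g (R := R) (H := H) w hw0 hw1).loc y F := by
  unfold bHZKPG
  exact member_loc_le (b := famKP (κ := κ) i b g (R := R) (H := H)) (i₀ := expoHalf) (w := wE w) (⟨s, hs0, hs1⟩ : Expo) hws _ _

end BondGraded

end Literature.MathematicalPhysics.QuantumFieldTheory.Balaban1983to89.B9SmoothHolderClassP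

end
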